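import Mathlib
import Literature.MathematicalPhysics.QuantumFieldTheory.BalabanImbrieJaffe1984to88.BIJ85AxialMinimizer413

/-!
# `BalabanImbrieJaffe1984to88.BIJ85SigmaForm421` — T. Bałaban, J. Imbrie, A. Jaffe, *Renormalization of the Higgs model:
minimizers, propagators and the stability of mean field theory*, Commun. Math. Phys. **97** (1985) 299–329
[BalabanImbrieJaffe1985]: Sect. 4.2–4.3 p. 310–311 — the quadratic form σ_k by the functional integral (4.2.1), typed as
printed; **(4.2.2) `σ_k = Q^e_k(I − ∂G_{k,Ax}∂^*)Q^{e*}_k` PROVED to satisfy it**; the p. 311 claim *"∂G_{k,Ax}∂^* is a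
projection operator"* PROVED; the (4.3.2) chain `⟨∂B, σ_k∂B⟩ = ⟨B, Δ_kB⟩` = the minimal curl energy of the class, PROVED

statement-level skeleton of published theorems with citation tags; proofs where landed; nothing here is a claim about the Yang–Mills mass gap

PDF held: `paper:balaban1985-cmp97-bij-higgs-minimizers` (journal page = PDF page + 298); p. 310–311 [PDF 12–13] read on the
renders `run/shared/lean/pub/pub-balaban/t4/b2b-balaban-t4-lit2/renders/bij1985/1985-cmp97-bij-higgs-minimizers-p012-x2.png`,
`…-p013-x2.png`.

THE PRINTED TEXT (verbatim).  p. 310: *"4.2. The Quadratic Action and Plaquette Fields. We begin with the definition of the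
basic quadratic form σ_k. Again we use a functional integral definition
exp(−½⟨f, σ_kf⟩) = Z_{k,Ax}^{−1}∫𝒟Aδ(Q_kA)δ_{k,Ax}(A)exp(−½‖∂A − Q^{e*}_kf‖²). (4.2.1) Here f is any real (Lie algebra) valued
field defined on unit lattice plaquettes. Clearly σ_k is related to the propagator G_{k,Ax} of Sect. 4.1. Comparing (4.2.1)
with (4.1.1) we find σ_k = Q^e_k(I − ∂G_{k,Ax}∂^*)Q^{e*}_k = η^{−2}I − Q^e_k∂G_{k,Ax}∂^*Q^{e*}_k. (4.2.2) Here we have used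
Q^e_kQ^{e*}_k = η^{−2}, see (2.24)."*  p. 311: *"This identity is a consequence of the fact that ∂G_{k,Ax}∂^* is a projection
operator. Alternatively, we compute from (4.1.1) and (4.2.1) that exp(−½⟨f, σ_kf⟩) = exp(½⟨∂^*Q^{e*}_kf, G_{k,Ax}∂^*Q^{e*}_kf⟩)
exp(−½‖Q^{e*}_kf‖²), from which (4.2.7) follows. 4.3. Quadratic Action for Curls. The quadratic form σ_k simplifies on curls,
namely for fields f of the form f = ∂B. In particular ⟨∂B, σ_k∂B⟩ = ⟨B, Δ_kB⟩, (4.3.1) which defines an action Δ_k. To give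
a functional integral representation for Δ_k, we note that exp(−½⟨∂B, σ_k∂B⟩) = Z_{k,Ax}^{−1}∫𝒟Aδ(Q_kA)δ_{k,Ax}(A)
exp(−½‖∂A − Q^{e*}_k∂B‖²) = Z_{k,Ax}^{−1}∫𝒟Aδ(Q_kA − B)δ_{k,Ax}(A)exp(−½‖∂A‖²) = exp(−½⟨B, Δ_kB⟩). (4.3.2) Here we have
performed a translation of A on surface bonds A → A + Q^{s*}_kB. We use the fact that the axial gauge condition is independent
of the surface bonds, we use ∂Q^{s*}_k = Q^{e*}_k∂, and we also use (2.19)."*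

WHAT IS TYPED / PROVED (SKELETON rows `C1.Eq4.2.1-4.2.2` and the (4.3.2) part of `C1.Eq4.3.1-4.3.3`, whose cells of record are
the carrier fields `BIJ85Sect4Statements.GaugeRG.sigma` / `.DeltaForm` and the ring identity `eq422`; lit-balaban HOME
`run/shared/lean/pub/lit-balaban/`, Phase-2 seat p09, third sibling of `…BIJ85AxialPropagator411` (G.5-34(d) taking announced
2026-08-21T01:25Z); unit `lit-balaban-p09`).  Setting of `…BIJ85AxialPropagator411` §2 / `…BIJ85AxialMinimizer413`: η-bond
fields `E`, η-plaquette fields `F`, curl `D : E → F`, linear constraint subspace `V` (support of `δ(Q_kA)δ_{k,Ax}(A)`), plus the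
unit-lattice plaquette fields `F'` and `Qes = Q^{e*}_k : F' → F`; `*` = adjoint for the printed pairings (so `Q^e_k = (Q^{e*}_k)^*`).
* §1 — `curlG V D = ∂G_{k,Ax}∂^*` IS A PROJECTION (no zero modes of ∂ on V): idempotent (`curlG_idem`), symmetric (`curlG_symm`),
  the identity on `∂V` (`curlG_apply_curl`) with range `∂V` (`curlG_mem_range`), and `‖g‖² = ‖Pg‖² + ‖(I−P)g‖²` (`norm_sq_split`).
* §2 — **(4.2.1)** VERBATIM as the defining property `IsSigmaForm V D Qes σ`; the operator **(4.2.2)** `sigmaOp V D Qes =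
  Q^e_k(I − ∂G_{k,Ax}∂^*)Q^{e*}_k`; PROVED: the shifted Gaussian integral `∫_V e^{−½‖∂v − g‖²} = e^{½⟨∂^*g,G∂^*g⟩ − ½‖g‖²}Z_{k,Ax}`
  (`integral_exp_shift`, from (4.1.1) = `isAxialPropagator_axialPropagator` at J = ∂^*g), the displayed p. 311 identity
  (`rhs421_eq`), **`isSigmaForm_sigmaOp`** ((4.2.2) satisfies (4.2.1)), uniqueness of the form (`form_eq_of_isSigmaForm`),
  `⟨f, σ_kf⟩ = ‖(I − ∂G∂^*)Q^{e*}_kf‖²` and `0 ≤ ⟨f, σ_kf⟩ ≤ ‖Q^{e*}_kf‖²` (`inner_sigmaOp_eq_norm_sq`, `sigmaOp_form_bounds` — the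
  inputs that `BIJ85Eq427Proof.eq427` (seat p30) takes as hypotheses, discharged for the concrete operator); and the (4.3.2)
  chain: `rhs421_at_curl` (the right member of (4.2.1) at `f₀` with `Q^{e*}_kf₀ = ∂A₀` equals `Z_{k,Ax}^{−1}Z_{k,Ax}(B)`,
  translation invariance + reflection invariance of the volume of V — unconditionally) and **`sigma_curl_eq_min_energy`**:
  `⟨f₀, σ_kf₀⟩ = ‖∂H_{k,Ax}B‖²` (the minimal curl energy of the class, `…BIJ85AxialMinimizer413`), `sigmaOp_curl_le`.
NOT DONE HERE.  The second expression of (4.2.2) needs `Q^e_kQ^{e*}_k = η^{−2}` ((2.24), row C1.Eq2.24) and is the ring identity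
`BIJ85Sect4Statements.eq422`; the translation datum `∂Q^{s*}_kB = Q^{e*}_k∂B` / (2.19) of (4.3.2) enters as the hypothesis
`Q^{e*}_kf₀ = ∂A₀` on a representative; (4.3.3)–(4.3.5) (the unit-lattice propagator C^{(k)} and its bounds, [Balaban1984PropagatorsII])
are not touched.  No new `def … : Prop` beyond the printed defining property (4.2.1); nothing is asserted beyond the kernel-checked
algebra and integrals.
-/

namespace Literature.MathematicalPhysics.QuantumFieldTheory.BalabanImbrieJaffe1984to88.BIJ85SigmaForm421

open MeasureTheory
open scoped RealInnerProductSpace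
open BIJ85AxialPropagator411 BIJ85AxialMinimizer413

noncomputable section

/-! ## §1  `∂G_{k,Ax}∂^*` is a projection operator (p. 311) -/

section Projection

variable {E F : Type*} [NormedAddCommGroup E] [InnerProductSpace ℝ E] [FiniteDimensional ℝ E]
  [NormedAddCommGroup F] [InnerProductSpace ℝ F] [FiniteDimensional ℝ F]

/-- **`∂G_{k,Ax}∂^*`** — the operator on η-plaquette fields whose projection property p. 311 invokes (*"This identity is a
consequence of the fact that ∂G_{k,Ax}∂^* is a projection operator"*), for `G_{k,Ax}` = `axialPropagator V D`.
[cite: BalabanImbrieJaffe1985, §4.2 p.311] -/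
def curlG (V : Submodule ℝ E) (D : E →ₗ[ℝ] F) : F →ₗ[ℝ] F :=
  D ∘ₗ axialPropagator V D ∘ₗ LinearMap.adjoint D

/-- `⟨w, S*S w⟩ = ‖Sw‖²`. [folklore] -/
private theorem inner_formOp_self' {W : Type*} [NormedAddCommGroup W] [InnerProductSpace ℝ W] [FiniteDimensional ℝ W]
    (S : W →ₗ[ℝ] F) (w : W) : ⟪w, formOp S w⟫ = ‖S w‖ ^ 2 := by
  unfold formOp
  rw [LinearMap.comp_apply, LinearMap.adjoint_inner_right, real_inner_self_eq_norm_sq]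

/-- `(S*S)⁻¹(S*S) = 1` for injective S (the left-inverse companion of `formOp_formInv`). [folklore] -/
private theorem formInv_formOp {W : Type*} [NormedAddCommGroup W] [InnerProductSpace ℝ W] [FiniteDimensional ℝ W]
    {S : W →ₗ[ℝ] F} (hS : Function.Injective S) (w : W) : formInv S (formOp S w) = w := by
  -- `formOp S` is injective, and `formOp S (formInv S (formOp S w)) = formOp S w`
  have hinj : Function.Injective (formOp S) := by
    intro x y hxy
    have h0 : formOp S (x - y) = 0 := by rw [map_sub, hxy, sub_self]
    have h1 : ‖S (x - y)‖ ^ 2 = 0 := by rw [← inner_formOp_self', h0, inner_zero_right]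
    have h2 : S (x - y) = 0 := norm_eq_zero.1 ((pow_eq_zero_iff two_ne_zero).1 h1)
    exact sub_eq_zero.1 (hS (by rw [h2, map_zero]))
  exact hinj (formOp_formInv hS _)

/-- `S*S = ι_V*∂*∂ι_V` applied: `ι*(∂*(∂(ι w))) = formOp (∂ι) w`. [folklore] -/
private theorem adj_adj_eq_formOp (V : Submodule ℝ E) (D : E →ₗ[ℝ] F) (w : V) :
    LinearMap.adjoint V.subtype (LinearMap.adjoint D (D (w : E))) = formOp (D ∘ₗ V.subtype) w := by
  unfold formOp
  rw [LinearMap.adjoint_comp]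
  rfl

omit [FiniteDimensional ℝ E] [FiniteDimensional ℝ F] in
/-- No zero modes of D on V ⇒ `S = D ι_V` is injective. [folklore] -/
private theorem injective_S' {V : Submodule ℝ E} {D : E →ₗ[ℝ] F} (hD : ∀ v : V, D (v : E) = 0 → v = 0) :
    Function.Injective (D ∘ₗ V.subtype) := by
  intro v w h
  have : (D ∘ₗ V.subtype) (v - w) = 0 := by rw [map_sub, h, sub_self]
  exact sub_eq_zero.1 (hD _ this)

/-- **`∂G_{k,Ax}∂^*` is idempotent** (no zero modes of ∂ on V). [cite: BalabanImbrieJaffe1985, §4.2 p.311] -/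
theorem curlG_idem {V : Submodule ℝ E} {D : E →ₗ[ℝ] F} (hD : ∀ v : V, D (v : E) = 0 → v = 0) (g : F) :
    curlG V D (curlG V D g) = curlG V D g := by
  have hS := injective_S' hD
  simp only [curlG, axialPropagator, LinearMap.comp_apply, Submodule.subtype_apply]
  rw [adj_adj_eq_formOp, formInv_formOp hS]

/-- **`∂G_{k,Ax}∂^*` is symmetric.** [cite: BalabanImbrieJaffe1985, §4.2 p.311] -/
theorem curlG_symm {V : Submodule ℝ E} {D : E →ₗ[ℝ] F} (hD : ∀ v : V, D (v : E) = 0 → v = 0) (g h : F) :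
    ⟪curlG V D g, h⟫ = ⟪g, curlG V D h⟫ := by
  have hS := injective_S' hD
  set S : V →ₗ[ℝ] F := D ∘ₗ V.subtype with hSdef
  -- both sides equal ⟨(S*S)⁻¹ b_g, b_h⟩-type expressions; use formOp symmetry via formOp_formInv
  have key : ∀ x y : V, ⟪formInv S x, y⟫ = ⟪x, formInv S y⟫ := by
    intro x y
    conv_lhs => rw [← formOp_formInv hS y]
    conv_rhs => rw [← formOp_formInv hS x]
    simp only [formOp, LinearMap.comp_apply, LinearMap.adjoint_inner_right, LinearMap.adjoint_inner_left]
  simp only [curlG, axialPropagator, LinearMap.comp_apply, Submodule.subtype_apply]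
  rw [← LinearMap.adjoint_inner_right D, ← Submodule.subtype_apply, ← LinearMap.adjoint_inner_right V.subtype, key,
    LinearMap.adjoint_inner_left, Submodule.subtype_apply, LinearMap.adjoint_inner_left]

/-- `∂G_{k,Ax}∂^*` fixes `∂V`: it is the identity on curls of constraint fields. [cite: BalabanImbrieJaffe1985, §4.2 p.311] -/
theorem curlG_apply_curl {V : Submodule ℝ E} {D : E →ₗ[ℝ] F} (hD : ∀ v : V, D (v : E) = 0 → v = 0) (v : V) :
    curlG V D (D (v : E)) = D (v : E) := by
  have hS := injective_S' hD
  simp only [curlG, axialPropagator, LinearMap.comp_apply, Submodule.subtype_apply]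
  rw [adj_adj_eq_formOp, formInv_formOp hS]

/-- … and its range is `∂V`. [cite: BalabanImbrieJaffe1985, §4.2 p.311] -/
theorem curlG_mem_range (V : Submodule ℝ E) (D : E →ₗ[ℝ] F) (g : F) :
    ∃ v : V, curlG V D g = D (v : E) := by
  simp only [curlG, axialPropagator, LinearMap.comp_apply, Submodule.subtype_apply]
  exact ⟨_, rfl⟩

/-- Hence `I − ∂G_{k,Ax}∂^*` kills curls of constraint fields and `‖g‖² = ‖Pg‖² + ‖(I − P)g‖²`.
[cite: BalabanImbrieJaffe1985, §4.2 p.311] -/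
theorem norm_sq_split {V : Submodule ℝ E} {D : E →ₗ[ℝ] F} (hD : ∀ v : V, D (v : E) = 0 → v = 0) (g : F) :
    ‖g‖ ^ 2 = ‖curlG V D g‖ ^ 2 + ‖g - curlG V D g‖ ^ 2 := by
  have horth : ⟪curlG V D g, g - curlG V D g⟫ = 0 := by
    rw [inner_sub_right, ← curlG_symm hD, curlG_idem hD, sub_self]
  have := @norm_add_sq_real F _ _ (curlG V D g) (g - curlG V D g)
  rw [add_sub_cancel, horth, mul_zero, add_zero] at this
  exact this

end Projection

/-! ## §2  (4.2.1): the quadratic form σ_k by a functional integral, and (4.2.2) -/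

section Sigma

variable {E F F' : Type*} [NormedAddCommGroup E] [InnerProductSpace ℝ E] [FiniteDimensional ℝ E]
  [MeasurableSpace E] [BorelSpace E]
  [NormedAddCommGroup F] [InnerProductSpace ℝ F] [FiniteDimensional ℝ F]
  [NormedAddCommGroup F'] [InnerProductSpace ℝ F'] [FiniteDimensional ℝ F']

/-- **(4.2.1) as printed — the DEFINING property of σ_k**, verbatim: *"We begin with the definition of the basic quadratic form
σ_k. Again we use a functional integral definition exp(−½⟨f, σ_kf⟩) = Z_{k,Ax}^{−1}∫𝒟Aδ(Q_kA)δ_{k,Ax}(A)exp(−½‖∂A − Q^{e*}_kf‖²).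
(4.2.1) Here f is any real (Lie algebra) valued field defined on unit lattice plaquettes."* — for the constraint subspace V,
the curl D, and `Qes = Q^{e*}_k` from the unit-lattice plaquette fields `F'` to the η-plaquette fields `F`.
[cite: BalabanImbrieJaffe1985, (4.2.1) p.310] -/
def IsSigmaForm (V : Submodule ℝ E) (D : E →ₗ[ℝ] F) (Qes : F' →ₗ[ℝ] F) (σ : F' →ₗ[ℝ] F') : Prop :=
  ∀ f : F', Real.exp (-(1 / 2) * ⟪f, σ f⟫) = (Z V D)⁻¹ * ∫ v : V, Real.exp (-(1 / 2) * ‖D (v : E) - Qes f‖ ^ 2)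

/-- **(4.2.2), first expression**: `σ_k = Q^e_k(I − ∂G_{k,Ax}∂^*)Q^{e*}_k`, `Q^e_k` the adjoint of `Q^{e*}_k` for the pairings
of the two plaquette spaces (the second printed expression `η^{−2}I − Q^e_k∂G_{k,Ax}∂^*Q^{e*}_k` is the ring identity
`BIJ85Sect4Statements.eq422` under the input `Q^e_kQ^{e*}_k = η^{−2}`, (2.24)). [cite: BalabanImbrieJaffe1985, (4.2.2) p.310] -/
def sigmaOp (V : Submodule ℝ E) (D : E →ₗ[ℝ] F) (Qes : F' →ₗ[ℝ] F) : F' →ₗ[ℝ] F' :=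
  LinearMap.adjoint Qes ∘ₗ (LinearMap.id - curlG V D) ∘ₗ Qes

omit [FiniteDimensional ℝ F'] in
/-- **The shifted Gaussian integral** behind "comparing (4.2.1) with (4.1.1)": for every η-plaquette field g,
`∫_V e^{−½‖∂v − g‖²}dv = e^{½⟨∂^*g, G_{k,Ax}∂^*g⟩ − ½‖g‖²}·Z_{k,Ax}` (no zero modes; from the source identity (4.1.1) at
J = ∂^*g). [cite: BalabanImbrieJaffe1985, (4.2.1)–(4.2.2) p.310] -/
theorem integral_exp_shift {V : Submodule ℝ E} {D : E →ₗ[ℝ] F} (hD : ∀ v : V, D (v : E) = 0 → v = 0) (g : F) :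
    ∫ v : V, Real.exp (-(1 / 2) * ‖D (v : E) - g‖ ^ 2) =
      Real.exp ((1 / 2) * ⟪LinearMap.adjoint D g, axialPropagator V D (LinearMap.adjoint D g)⟫ - (1 / 2) * ‖g‖ ^ 2) *
        Z V D := by
  obtain ⟨h411, hZ⟩ := isAxialPropagator_axialPropagator V D hD
  have h := h411 (LinearMap.adjoint D g)
  -- h : exp(½⟨J, GJ⟩) = Z⁻¹ * gen V D J, J = ∂^*g
  have hgen : gen V D (LinearMap.adjoint D g) = Real.exp ((1 / 2) * ‖g‖ ^ 2) *
      ∫ v : V, Real.exp (-(1 / 2) * ‖D (v : E) - g‖ ^ 2) := by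
    unfold gen
    rw [← integral_const_mul]
    refine integral_congr_ae (Filter.Eventually.of_forall fun v => ?_)
    simp only
    rw [← Real.exp_add, LinearMap.adjoint_inner_right, @norm_sub_sq_real]
    congr 1
    ring
  rw [hgen] at h
  have hE : Real.exp ((1 / 2) * ‖g‖ ^ 2) ≠ 0 := (Real.exp_pos _).ne'
  -- solve for the integral
  have : ∫ v : V, Real.exp (-(1 / 2) * ‖D (v : E) - g‖ ^ 2) =
      Z V D * Real.exp (-((1 / 2) * ‖g‖ ^ 2)) *
        Real.exp ((1 / 2) * ⟪LinearMap.adjoint D g, axialPropagator V D (LinearMap.adjoint D g)⟫) := by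
    rw [h, Real.exp_neg]
    field_simp
  rw [this, sub_eq_add_neg, Real.exp_add]
  ring

omit [FiniteDimensional ℝ F'] in
/-- **The identity displayed on p. 311**, verbatim: *"Alternatively, we compute from (4.1.1) and (4.2.1) that
exp(−½⟨f, σ_kf⟩) = exp(½⟨∂^*Q^{e*}_kf, G_{k,Ax}∂^*Q^{e*}_kf⟩)exp(−½‖Q^{e*}_kf‖²)"* — here for the right member of (4.2.1)
(so for every σ_k satisfying (4.2.1)); no zero modes. [cite: BalabanImbrieJaffe1985, §4.2 p.311] -/
theorem rhs421_eq {V : Submodule ℝ E} {D : E →ₗ[ℝ] F} (hD : ∀ v : V, D (v : E) = 0 → v = 0) (Qes : F' →ₗ[ℝ] F) (f : F') :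
    (Z V D)⁻¹ * ∫ v : V, Real.exp (-(1 / 2) * ‖D (v : E) - Qes f‖ ^ 2) =
      Real.exp ((1 / 2) * ⟪LinearMap.adjoint D (Qes f), axialPropagator V D (LinearMap.adjoint D (Qes f))⟫) *
        Real.exp (-(1 / 2) * ‖Qes f‖ ^ 2) := by
  have hZ := (isAxialPropagator_axialPropagator V D hD).2
  rw [integral_exp_shift hD, ← Real.exp_add]
  rw [mul_comm (Real.exp _) (Z V D), ← mul_assoc, inv_mul_cancel₀ hZ.ne', one_mul]
  congr 1
  ring

omit [MeasurableSpace E] [BorelSpace E] in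
/-- The quadratic form of `σ_k = Q^e_k(I − ∂G_{k,Ax}∂^*)Q^{e*}_k`: `⟨f, σ_kf⟩ = ‖Q^{e*}_kf‖² − ⟨∂^*Q^{e*}_kf, G_{k,Ax}∂^*Q^{e*}_kf⟩`.
[cite: BalabanImbrieJaffe1985, (4.2.2) p.310] -/
theorem inner_sigmaOp (V : Submodule ℝ E) (D : E →ₗ[ℝ] F) (Qes : F' →ₗ[ℝ] F) (f : F') :
    ⟪f, sigmaOp V D Qes f⟫ =
      ‖Qes f‖ ^ 2 - ⟪LinearMap.adjoint D (Qes f), axialPropagator V D (LinearMap.adjoint D (Qes f))⟫ := by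
  simp only [sigmaOp, curlG, LinearMap.comp_apply, LinearMap.sub_apply, LinearMap.id_apply,
    LinearMap.adjoint_inner_right, inner_sub_right, real_inner_self_eq_norm_sq]
  rw [← LinearMap.adjoint_inner_left D]

/-- **(4.2.2)**, verbatim: *"Clearly σ_k is related to the propagator G_{k,Ax} of Sect. 4.1. Comparing (4.2.1) with (4.1.1)
we find σ_k = Q^e_k(I − ∂G_{k,Ax}∂^*)Q^{e*}_k"* — PROVED: this operator satisfies the defining identity (4.2.1) (no zero modes of
∂ on the constraint subspace). [cite: BalabanImbrieJaffe1985, (4.2.2) p.310] -/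
theorem isSigmaForm_sigmaOp {V : Submodule ℝ E} {D : E →ₗ[ℝ] F} (hD : ∀ v : V, D (v : E) = 0 → v = 0)
    (Qes : F' →ₗ[ℝ] F) : IsSigmaForm V D Qes (sigmaOp V D Qes) := by
  intro f
  rw [rhs421_eq hD, inner_sigmaOp, ← Real.exp_add]
  congr 1
  ring

omit [FiniteDimensional ℝ F] [FiniteDimensional ℝ F'] in
/-- (4.2.1) determines the quadratic form `⟨f, σ_kf⟩`: two operators satisfying it have the same form.
[cite: BalabanImbrieJaffe1985, (4.2.1) p.310] -/
theorem form_eq_of_isSigmaForm {V : Submodule ℝ E} {D : E →ₗ[ℝ] F} {Qes : F' →ₗ[ℝ] F} {σ σ' : F' →ₗ[ℝ] F'}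
    (h : IsSigmaForm V D Qes σ) (h' : IsSigmaForm V D Qes σ') (f : F') : ⟪f, σ f⟫ = ⟪f, σ' f⟫ := by
  have := Real.exp_injective ((h f).trans (h' f).symm)
  linarith

omit [MeasurableSpace E] [BorelSpace E] in
/-- **σ_k is a nonnegative form bounded by `‖Q^{e*}_kf‖²`**: `0 ≤ ⟨f, σ_kf⟩ = ‖(I − ∂G∂^*)Q^{e*}_kf‖² ≤ ‖Q^{e*}_kf‖²` — the
projection property of `∂G_{k,Ax}∂^*` (p. 311; the identity `⟨f, σ_kf⟩ = ‖f_k‖²` is (4.2.7), row C1.Eq4.2.4-4.2.7 /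
`BIJ85Eq427Proof.eq427`, whose hypotheses this discharges for the concrete operator). [cite: BalabanImbrieJaffe1985, (4.2.7) p.311] -/
theorem inner_sigmaOp_eq_norm_sq {V : Submodule ℝ E} {D : E →ₗ[ℝ] F} (hD : ∀ v : V, D (v : E) = 0 → v = 0)
    (Qes : F' →ₗ[ℝ] F) (f : F') :
    ⟪f, sigmaOp V D Qes f⟫ = ‖Qes f - curlG V D (Qes f)‖ ^ 2 := by
  have hsplit := norm_sq_split hD (V := V) (D := D) (Qes f)
  have h1 : ⟪f, sigmaOp V D Qes f⟫ = ‖Qes f‖ ^ 2 - ⟪Qes f, curlG V D (Qes f)⟫ := by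
    simp only [sigmaOp, LinearMap.comp_apply, LinearMap.sub_apply, LinearMap.id_apply, LinearMap.adjoint_inner_right,
      inner_sub_right, real_inner_self_eq_norm_sq]
  have h2 : ⟪Qes f, curlG V D (Qes f)⟫ = ‖curlG V D (Qes f)‖ ^ 2 := by
    conv_lhs => rw [← curlG_idem hD (Qes f)]
    rw [← curlG_symm hD, real_inner_self_eq_norm_sq]
  rw [h1, h2, hsplit]
  ring

omit [MeasurableSpace E] [BorelSpace E] in
/-- `0 ≤ ⟨f, σ_kf⟩ ≤ ‖Q^{e*}_kf‖²`. [cite: BalabanImbrieJaffe1985, (4.2.2) p.310] -/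
theorem sigmaOp_form_bounds {V : Submodule ℝ E} {D : E →ₗ[ℝ] F} (hD : ∀ v : V, D (v : E) = 0 → v = 0)
    (Qes : F' →ₗ[ℝ] F) (f : F') :
    0 ≤ ⟪f, sigmaOp V D Qes f⟫ ∧ ⟪f, sigmaOp V D Qes f⟫ ≤ ‖Qes f‖ ^ 2 := by
  rw [inner_sigmaOp_eq_norm_sq hD]
  refine ⟨sq_nonneg _, ?_⟩
  rw [norm_sq_split hD (V := V) (D := D) (Qes f)]
  exact le_add_of_nonneg_left (sq_nonneg _)

/-! ### (4.3.1)–(4.3.2): σ_k on curls = the minimal curl energy of the constraint class -/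

omit [FiniteDimensional ℝ F] [FiniteDimensional ℝ F'] in
/-- **(4.3.2)**, verbatim: *"exp(−½⟨∂B, σ_k∂B⟩) = Z_{k,Ax}^{−1}∫𝒟Aδ(Q_kA)δ_{k,Ax}(A)exp(−½‖∂A − Q^{e*}_k∂B‖²)
= Z_{k,Ax}^{−1}∫𝒟Aδ(Q_kA − B)δ_{k,Ax}(A)exp(−½‖∂A‖²) = exp(−½⟨B, Δ_kB⟩). (4.3.2) Here we have performed a translation of A
on surface bonds A → A + Q^{s*}_kB … we use ∂Q^{s*}_k = Q^{e*}_k∂, and we also use (2.19)."* — the middle equality, for a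
representative `A₀` (= Q^{s*}_kB) of the class of B with `Q^{e*}_k f₀ = ∂A₀` (`f₀ = ∂B`): the right member of (4.2.1) at
`f₀` is `Z_{k,Ax}^{−1}Z_{k,Ax}(B)` (translation `v ↦ A₀ + v` composed with `v ↦ −v`, both preserving the volume of V).
[cite: BalabanImbrieJaffe1985, (4.3.2) p.311] -/
theorem rhs421_at_curl (V : Submodule ℝ E) (D : E →ₗ[ℝ] F) {Qes : F' →ₗ[ℝ] F} {f₀ : F'} {A₀ : E}
    (hA₀ : Qes f₀ = D A₀) :
    (Z V D)⁻¹ * ∫ v : V, Real.exp (-(1 / 2) * ‖D (v : E) - Qes f₀‖ ^ 2) = (Z V D)⁻¹ * Zax V D A₀ := by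
  congr 1
  unfold Zax
  rw [← integral_neg_eq_self _ (volume : Measure V)]
  refine integral_congr_ae (Filter.Eventually.of_forall fun v => ?_)
  simp only [Submodule.coe_neg, hA₀]
  rw [← map_sub, show -(v : E) - A₀ = -(A₀ + (v : E)) by abel, map_neg, norm_neg]

omit [FiniteDimensional ℝ F'] in
/-- **(4.3.1)–(4.3.2): `⟨∂B, σ_k∂B⟩ = ⟨B, Δ_kB⟩ = ‖∂H_{k,Ax}B‖²`** — for any σ_k satisfying (4.2.1), the value of its form at a
curl `f₀ = ∂B` is the MINIMAL curl energy `‖∂H_{k,Ax}B‖²` of the constraint class of B (representative `A₀`,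
`Q^{e*}_kf₀ = ∂A₀`), i.e. `exp(−½⟨∂B, σ_k∂B⟩) = Z_{k,Ax}^{−1}Z_{k,Ax}(B) = exp(−½‖∂H_{k,Ax}B‖²)`; this is the action `Δ_k`
that (4.3.1) *"⟨∂B, σ_k∂B⟩ = ⟨B, Δ_kB⟩, (4.3.1) which defines an action Δ_k"* names (no zero modes).
[cite: BalabanImbrieJaffe1985, (4.3.1)–(4.3.2) p.311] -/
theorem sigma_curl_eq_min_energy {V : Submodule ℝ E} {D : E →ₗ[ℝ] F} (hD : ∀ v : V, D (v : E) = 0 → v = 0)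
    {Qes : F' →ₗ[ℝ] F} {σ : F' →ₗ[ℝ] F'} (hσ : IsSigmaForm V D Qes σ) {f₀ : F'} {A₀ : E} (hA₀ : Qes f₀ = D A₀) :
    ⟪f₀, σ f₀⟫ = ‖D (Hax V D A₀)‖ ^ 2 := by
  have h := hσ f₀
  rw [rhs421_at_curl V D hA₀, Zax_eq hD] at h
  have hZ := (isAxialPropagator_axialPropagator V D hD).2
  rw [mul_comm (Real.exp _) (Z V D), ← mul_assoc, inv_mul_cancel₀ hZ.ne', one_mul] at h
  have := Real.exp_injective h
  rw [Hax_eq_minimizer hD]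
  linarith

/-- The same for the operator of (4.2.2): `⟨∂B, σ_k∂B⟩ = ‖∂H_{k,Ax}B‖² ≤ ‖∂A‖²` for every A of the class of B.
[cite: BalabanImbrieJaffe1985, (4.3.1)–(4.3.2) p.311] -/
theorem sigmaOp_curl_le {V : Submodule ℝ E} {D : E →ₗ[ℝ] F} (hD : ∀ v : V, D (v : E) = 0 → v = 0)
    (Qes : F' →ₗ[ℝ] F) {f₀ : F'} {A₀ : E} (hA₀ : Qes f₀ = D A₀) {A : E} (hA : A - A₀ ∈ V) :
    ⟪f₀, sigmaOp V D Qes f₀⟫ ≤ ‖D A‖ ^ 2 := by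
  rw [sigma_curl_eq_min_energy hD (isSigmaForm_sigmaOp hD Qes) hA₀]
  exact pow_le_pow_left₀ (norm_nonneg _) (norm_D_Hax_le hD A₀ hA) 2

end Sigma

end

end Literature.MathematicalPhysics.QuantumFieldTheory.BalabanImbrieJaffe1984to88.BIJ85SigmaForm421
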